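import Summits.NavierStokesRegularity.NavierStokesRegularity.Theorems.TypeICertificateLadderRungReynoldsOneWeightedSliceTools

/-!
# The weighted `L^{5/2}` vorticity slice inequality: the three integrations by parts — crux
stmt-NavierStokesRegularity-2882 (`TypeICertificateLadder.RungReynoldsOne`), line
`lp-vorticity-young-budget`, stub `stub_weightedVorticitySlice` (S1)

Helper file (theorems only) for the stub `stub_weightedVorticitySlice` (main file
`…RungReynoldsOneWeightedSlice.lean`). For a field `w ∈ C³(ℝ³; ℝ³)` (the vorticity), a velocity
`v ∈ C¹(ℝ³; ℝ³)`, the weight `wt = (‖w‖²+1)^{1/4}`, the weighted field `Φ(w) = wt w` and the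
potential `F(w) = (‖w‖²+1)^{5/4} − 1`, all three terms of the weighted vorticity budget are
integrated over `ℝ³` under the natural `L²`/`L^∞` hypotheses (`w, ∂ᵢw, ∂ᵢ∂ᵢw ∈ L²`, bounded
weight, `v` bounded with bounded gradient):

* `weightedSlice_viscous`: `∫ ⟪Δw, Φ(w)⟫ = −∫ Σᵢ ⟪∂ᵢw, ∂ᵢ(Φ∘w)⟫` (Green's identity,
  `integral_sum_inner_fderiv_fderiv_eq_neg_integral_inner_laplacian`);
* `weightedSlice_transport`: `∫ wt ⟪w, (v·∇)w⟫ = (2/5) ∫ ⟪∇(F∘w), v⟫ = 0` for `div v = 0`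
  (`integral_inner_gradient_eq_zero_of_isDivFree_R3`);
* `weightedSlice_stretching`: `∫ wt ⟪w, (w·∇)v⟫ = −∫ ⟪D(Φ∘w)(w), v⟫` for `div w = 0`
  (coordinatewise `integral_bilinear_fderiv_right_eq_neg_left_of_integrable`).

Sources: P. G. Lemarié-Rieusset, *The Navier–Stokes Problem in the 21st Century* (2016), §11.6
(the vorticity equation (11.60) and its energy estimates); the computations are elementary.
[folklore]
-/

noncomputable section

open Set Filter Topology MeasureTheory
open scoped RealInnerProductSpace ENNReal NNReal Laplacian ContDiff
open Literature.Analysis.FluidPDE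

namespace Summit.NavierStokesRegularity.NavierStokesRegularity.Theorems.RungReynoldsOne

-- the problem directory repeats the summit name (`NavierStokesRegularity/NavierStokesRegularity`)
set_option linter.dupNamespace false

open WeightedSlice

local notation "E3" => EuclideanSpace ℝ (Fin 3)

/-- The weighted field `Φ∘w = (‖w‖²+1)^{1/4} w` of a field `w` (syntactic abbreviation). -/
local notation "Φ[" w "]" => fun y => (‖w y‖ ^ 2 + 1) ^ (1 / 4 : ℝ) • w y

/-! ### The viscous term -/

/-- **Viscous term.** For `w ∈ C³(ℝ³; ℝ³)` with bounded weight `(‖w‖²+1)^{1/4} ≤ W₀` and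
`w, ∂ᵢw, ∂ᵢ∂ᵢw ∈ L²`: `∫ ⟪Δw, Φ(w)⟫ = −∫ Σᵢ ⟪∂ᵢw, ∂ᵢ(Φ∘w)⟫`, both integrands being integrable
(Green's identity `integral_sum_inner_fderiv_fderiv_eq_neg_integral_inner_laplacian` with the `C¹`
test field `Φ∘w`, `‖Φ(w)‖ = wt‖w‖`, `‖D(Φ∘w)eᵢ‖ ≤ (3/2) wt ‖∂ᵢw‖`). [folklore] -/
theorem weightedSlice_viscous {w : E3 → E3} (hw : ContDiff ℝ 3 w) {W₀ : ℝ}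
    (hwt : ∀ x, (‖w x‖ ^ 2 + 1) ^ (1 / 4 : ℝ) ≤ W₀)
    (l2w : ∫⁻ x, ‖w x‖ₑ ^ 2 < ⊤)
    (l2dw : ∀ i, ∫⁻ x, ‖fderiv ℝ w x (EuclideanSpace.basisFun (Fin 3) ℝ i)‖ₑ ^ 2 < ⊤)
    (l2ddw : ∀ i, ∫⁻ x, ‖fderiv ℝ (fun y => fderiv ℝ w y (EuclideanSpace.basisFun (Fin 3) ℝ i)) x
      (EuclideanSpace.basisFun (Fin 3) ℝ i)‖ₑ ^ 2 < ⊤) :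
    Integrable (fun x => ⟪(Δ w) x, (‖w x‖ ^ 2 + 1) ^ (1 / 4 : ℝ) • w x⟫) volume ∧
    Integrable (fun x => ∑ i, ⟪fderiv ℝ w x (EuclideanSpace.basisFun (Fin 3) ℝ i),
      fderiv ℝ Φ[w] x (EuclideanSpace.basisFun (Fin 3) ℝ i)⟫) volume ∧
    ∫ x, ⟪(Δ w) x, (‖w x‖ ^ 2 + 1) ^ (1 / 4 : ℝ) • w x⟫ =
      -∫ x, ∑ i, ⟪fderiv ℝ w x (EuclideanSpace.basisFun (Fin 3) ℝ i),
        fderiv ℝ Φ[w] x (EuclideanSpace.basisFun (Fin 3) ℝ i)⟫ := by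
  set e := EuclideanSpace.basisFun (Fin 3) ℝ with he
  -- regularity and continuity
  have hw2 : ContDiff ℝ 2 w := hw.of_le (by norm_num)
  have hw1 : ContDiff ℝ 1 w := hw.of_le (by norm_num)
  have hdw : Differentiable ℝ w := hw1.differentiable one_ne_zero
  have hΦs : ContDiff ℝ 1 Φ[w] :=
    (((hw1.norm_sq ℝ).add contDiff_const).rpow_const_of_ne fun x => by positivity).smul hw1
  have cw : Continuous w := hw.continuous
  have cΦ : Continuous Φ[w] := hΦs.continuous
  have cdw : ∀ i, Continuous fun x => fderiv ℝ w x (e i) := fun i =>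
    (hw1.continuous_fderiv one_ne_zero).clm_apply continuous_const
  have cddw : ∀ i, Continuous fun x => fderiv ℝ (fun y => fderiv ℝ w y (e i)) x (e i) := fun i =>
    (((hw2.fderiv_right (m := 1) le_rfl).clm_apply contDiff_const).continuous_fderiv
      one_ne_zero).clm_apply continuous_const
  have cdΦ : ∀ i, Continuous fun x => fderiv ℝ Φ[w] x (e i) := fun i =>
    (hΦs.continuous_fderiv one_ne_zero).clm_apply continuous_const
  -- pointwise bounds
  have nΦ : ∀ x, ‖(‖w x‖ ^ 2 + 1) ^ (1 / 4 : ℝ) • w x‖ ≤ W₀ * ‖w x‖ := fun x => by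
    rw [norm_weight_smul]
    exact mul_le_mul_of_nonneg_right (hwt x) (norm_nonneg _)
  have ndΦ : ∀ x i, ‖fderiv ℝ Φ[w] x (e i)‖ ≤ 3 / 2 * W₀ * ‖fderiv ℝ w x (e i)‖ := fun x i => by
    rw [fderiv_weightedField_apply (hdw x) (e i)]
    calc _ ≤ 3 / 2 * (‖w x‖ ^ 2 + 1) ^ (1 / 4 : ℝ) * ‖fderiv ℝ w x (e i)‖ :=
          norm_weightedField_deriv_le (w x) (fderiv ℝ w x (e i))
      _ ≤ 3 / 2 * W₀ * ‖fderiv ℝ w x (e i)‖ := by gcongr; exact hwt x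
  have hin : ∀ (a b : E3) {C r : ℝ}, ‖b‖ ≤ C * r → ‖⟪a, b⟫‖ ≤ C * ‖a‖ * r :=
    fun a b C r h =>
    calc ‖⟪a, b⟫‖ ≤ ‖a‖ * ‖b‖ := norm_inner_le_norm _ _
      _ ≤ ‖a‖ * (C * r) := mul_le_mul_of_nonneg_left h (norm_nonneg _)
      _ = C * ‖a‖ * r := by ring
  -- integrability of the three pairings
  have i1 : ∀ i, Integrable (fun x => ⟪fderiv ℝ (fun y => fderiv ℝ w y (e i)) x (e i),
      (‖w x‖ ^ 2 + 1) ^ (1 / 4 : ℝ) • w x⟫) volume := fun i =>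
    integrable_of_norm_le_const_mul_mul W₀ ((cddw i).inner cΦ) (cddw i) cw (l2ddw i) l2w
      fun x => hin _ _ (nΦ x)
  have i2 : ∀ i, Integrable (fun x => ⟪fderiv ℝ w x (e i), fderiv ℝ Φ[w] x (e i)⟫) volume :=
    fun i =>
    integrable_of_norm_le_const_mul_mul (3 / 2 * W₀) ((cdw i).inner (cdΦ i)) (cdw i) (cdw i)
      (l2dw i) (l2dw i) fun x => hin _ _ (ndΦ x i)
  have i3 : ∀ i, Integrable (fun x => ⟪fderiv ℝ w x (e i), (‖w x‖ ^ 2 + 1) ^ (1 / 4 : ℝ) • w x⟫)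
      volume := fun i =>
    integrable_of_norm_le_const_mul_mul W₀ ((cdw i).inner cΦ) (cdw i) cw (l2dw i) l2w
      fun x => hin _ _ (nΦ x)
  have hG := integral_sum_inner_fderiv_fderiv_eq_neg_integral_inner_laplacian hw2 hΦs i1 i2 i3
  have iLap : Integrable (fun x => ⟪(Δ w) x, (‖w x‖ ^ 2 + 1) ^ (1 / 4 : ℝ) • w x⟫) volume := by
    refine (integrable_finsetSum Finset.univ fun i _ => i1 i).congr
      (Eventually.of_forall fun x => ?_)
    dsimp only
    rw [laplacian_eq_sum_fderiv_fderiv e hw2 x, sum_inner]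
  refine ⟨iLap, integrable_finsetSum Finset.univ fun i _ => i2 i, ?_⟩
  rw [hG, neg_neg]

/-! ### The transport term -/

/-- **Transport term.** For `v ∈ C¹` divergence free and bounded with bounded gradient, and
`w ∈ C²` with bounded weight and `w, ∂ᵢw ∈ L²`:
`∫ (‖w‖²+1)^{1/4} ⟪w, (v·∇)w⟫ = (2/5) ∫ ⟪∇(F∘w), v⟫ = 0`, `F(y) = (‖y‖²+1)^{5/4} − 1`
(`integral_inner_gradient_eq_zero_of_isDivFree_R3`; `0 ≤ F(y) ≤ (5/4)(‖y‖²+1)^{1/4}‖y‖²`).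
[folklore] -/
theorem weightedSlice_transport {v w : E3 → E3} (hv : ContDiff ℝ 1 v) (hw : ContDiff ℝ 2 w)
    (hdiv : VectorCalculus.IsDivFree v) {M B W₀ : ℝ} (hM : ∀ x, ‖v x‖ ≤ M)
    (hB : ∀ x, ‖fderiv ℝ v x‖ ≤ B) (hwt : ∀ x, (‖w x‖ ^ 2 + 1) ^ (1 / 4 : ℝ) ≤ W₀)
    (l2w : ∫⁻ x, ‖w x‖ₑ ^ 2 < ⊤)
    (l2dw : ∀ i, ∫⁻ x, ‖fderiv ℝ w x (EuclideanSpace.basisFun (Fin 3) ℝ i)‖ₑ ^ 2 < ⊤) :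
    Integrable (fun x => (‖w x‖ ^ 2 + 1) ^ (1 / 4 : ℝ) * ⟪w x, fderiv ℝ w x (v x)⟫) volume ∧
    ∫ x, (‖w x‖ ^ 2 + 1) ^ (1 / 4 : ℝ) * ⟪w x, fderiv ℝ w x (v x)⟫ = 0 := by
  set e := EuclideanSpace.basisFun (Fin 3) ℝ with he
  have he1 : ∀ i, ‖e i‖ = 1 := fun i => by simp [he]
  set F : E3 → ℝ := fun y => (‖w y‖ ^ 2 + 1) ^ (5 / 4 : ℝ) - 1 with hF
  -- regularity and continuity
  have hw1 : ContDiff ℝ 1 w := hw.of_le (by norm_num)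
  have hdw : Differentiable ℝ w := hw1.differentiable one_ne_zero
  have hFs : ContDiff ℝ 1 F :=
    (((hw1.norm_sq ℝ).add contDiff_const).rpow_const_of_ne fun x => by positivity).sub
      contDiff_const
  have cv : Continuous v := hv.continuous
  have cw : Continuous w := hw.continuous
  have cF : Continuous F := hFs.continuous
  have cdw : ∀ i, Continuous fun x => fderiv ℝ w x (e i) := fun i =>
    (hw1.continuous_fderiv one_ne_zero).clm_apply continuous_const
  have cdv : ∀ i, Continuous fun x => fderiv ℝ v x (e i) := fun i =>
    (hv.continuous_fderiv one_ne_zero).clm_apply continuous_const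
  have cdF : ∀ i, Continuous fun x => fderiv ℝ F x (e i) := fun i =>
    (hFs.continuous_fderiv one_ne_zero).clm_apply continuous_const
  -- the derivative of the potential
  have hdF : ∀ x u, fderiv ℝ F x u =
      5 / 2 * (‖w x‖ ^ 2 + 1) ^ (1 / 4 : ℝ) * ⟪w x, fderiv ℝ w x u⟫ := fun x u =>
    fderiv_potential_apply (hdw x) u
  -- pointwise bounds
  have hei : ∀ i (y : E3), ‖⟪e i, y⟫‖ ≤ ‖y‖ := fun i y =>
    (norm_inner_le_norm (𝕜 := ℝ) (e i) y).trans (by rw [he1, one_mul])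
  have nF : ∀ x, ‖F x‖ ≤ 5 / 4 * W₀ * ‖w x‖ * ‖w x‖ := fun x => by
    rw [Real.norm_of_nonneg (potential_nonneg (w x))]
    calc F x ≤ 5 / 4 * (‖w x‖ ^ 2 + 1) ^ (1 / 4 : ℝ) * ‖w x‖ ^ 2 := potential_le (w x)
      _ ≤ 5 / 4 * W₀ * ‖w x‖ ^ 2 := by gcongr; exact hwt x
      _ = 5 / 4 * W₀ * ‖w x‖ * ‖w x‖ := by ring
  have hW₀ : 0 ≤ W₀ := (Real.rpow_nonneg (by positivity) _).trans (hwt 0)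
  have ndF : ∀ x i, ‖fderiv ℝ F x (e i)‖ ≤ 5 / 2 * W₀ * ‖w x‖ * ‖fderiv ℝ w x (e i)‖ :=
    fun x i => by
    rw [hdF, Real.norm_eq_abs, abs_mul, abs_mul,
      abs_of_nonneg (Real.rpow_nonneg (by positivity) _), abs_of_pos (by norm_num : (0:ℝ) < 5 / 2)]
    calc 5 / 2 * (‖w x‖ ^ 2 + 1) ^ (1 / 4 : ℝ) * |⟪w x, fderiv ℝ w x (e i)⟫|
        ≤ 5 / 2 * W₀ * (‖w x‖ * ‖fderiv ℝ w x (e i)‖) :=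
          mul_le_mul (mul_le_mul_of_nonneg_left (hwt x) (by norm_num))
            (abs_real_inner_le_norm _ _) (abs_nonneg _) (by positivity)
      _ = 5 / 2 * W₀ * ‖w x‖ * ‖fderiv ℝ w x (e i)‖ := by ring
  -- integrability hypotheses of the divergence identity
  have h1 : ∀ i, Integrable (fun x => ⟪e i, v x⟫ * fderiv ℝ F x (e i)) volume := fun i => by
    refine integrable_of_norm_le_const_mul_mul (M * (5 / 2 * W₀))
      ((continuous_const.inner cv).mul (cdF i)) cw (cdw i) l2w (l2dw i) fun x => ?_
    rw [norm_mul]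
    have ha : ‖⟪e i, v x⟫‖ ≤ M := (hei i (v x)).trans (hM x)
    have hM0 : 0 ≤ M := (norm_nonneg _).trans (hM x)
    calc ‖⟪e i, v x⟫‖ * ‖fderiv ℝ F x (e i)‖
        ≤ M * (5 / 2 * W₀ * ‖w x‖ * ‖fderiv ℝ w x (e i)‖) :=
          mul_le_mul ha (ndF x i) (norm_nonneg _) hM0
      _ = M * (5 / 2 * W₀) * ‖w x‖ * ‖fderiv ℝ w x (e i)‖ := by ring
  have h2 : ∀ i, Integrable (fun x => ⟪e i, fderiv ℝ v x (e i)⟫ * F x) volume := fun i => by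
    refine integrable_of_norm_le_const_mul_mul (B * (5 / 4 * W₀))
      ((continuous_const.inner (cdv i)).mul cF) cw cw l2w l2w fun x => ?_
    rw [norm_mul]
    have ha : ‖⟪e i, fderiv ℝ v x (e i)⟫‖ ≤ B :=
      (hei i _).trans (((fderiv ℝ v x).le_opNorm (e i)).trans (by rw [he1, mul_one]; exact hB x))
    have hB0 : 0 ≤ B := (norm_nonneg _).trans (hB x)
    calc ‖⟪e i, fderiv ℝ v x (e i)⟫‖ * ‖F x‖ ≤ B * (5 / 4 * W₀ * ‖w x‖ * ‖w x‖) :=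
          mul_le_mul ha (nF x) (norm_nonneg _) hB0
      _ = B * (5 / 4 * W₀) * ‖w x‖ * ‖w x‖ := by ring
  have h3 : ∀ i, Integrable (fun x => ⟪e i, v x⟫ * F x) volume := fun i => by
    refine integrable_of_norm_le_const_mul_mul (M * (5 / 4 * W₀))
      ((continuous_const.inner cv).mul cF) cw cw l2w l2w fun x => ?_
    rw [norm_mul]
    have ha : ‖⟪e i, v x⟫‖ ≤ M := (hei i (v x)).trans (hM x)
    have hM0 : 0 ≤ M := (norm_nonneg _).trans (hM x)
    calc ‖⟪e i, v x⟫‖ * ‖F x‖ ≤ M * (5 / 4 * W₀ * ‖w x‖ * ‖w x‖) :=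
          mul_le_mul ha (nF x) (norm_nonneg _) hM0
      _ = M * (5 / 4 * W₀) * ‖w x‖ * ‖w x‖ := by ring
  have hzero := integral_inner_gradient_eq_zero_of_isDivFree_R3 hFs hv hdiv h1 h2 h3
  -- the weighted transport density is `(2/5) ⟪∇(F∘w), v⟫`
  have hgrad : ∀ x, ⟪gradient F x, v x⟫ =
      5 / 2 * ((‖w x‖ ^ 2 + 1) ^ (1 / 4 : ℝ) * ⟪w x, fderiv ℝ w x (v x)⟫) := fun x => by
    rw [gradient, InnerProductSpace.toDual_symm_apply, hdF]
    ring
  have igrad : Integrable (fun x => ⟪gradient F x, v x⟫) volume := by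
    refine (integrable_finsetSum Finset.univ fun i _ => h1 i).congr
      (Eventually.of_forall fun x => ?_)
    exact (inner_gradient_eq_sum_basisFun F x (v x)).symm
  have hfun : (fun x => (‖w x‖ ^ 2 + 1) ^ (1 / 4 : ℝ) * ⟪w x, fderiv ℝ w x (v x)⟫) =
      fun x => 2 / 5 * ⟪gradient F x, v x⟫ := by
    funext x
    rw [hgrad x]
    ring
  rw [hfun]
  refine ⟨igrad.const_mul _, ?_⟩
  rw [integral_const_mul, hzero, mul_zero]

/-! ### The stretching term -/

/-- **Stretching term, integrated by parts onto the velocity.** For `v ∈ C¹` bounded with bounded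
gradient and `w ∈ C²` with `div w = 0`, bounded weight and `w, ∂ᵢw ∈ L²`:
`∫ (‖w‖²+1)^{1/4} ⟪w, (w·∇)v⟫ = Σⱼ ∫ ⟪wⱼ Φ(w), ∂ⱼv⟫ = −∫ ⟪D(Φ∘w)(w), v⟫`, since
`Σⱼ ∂ⱼ(wⱼ Φ(w)) = (div w) Φ(w) + D(Φ∘w)(w)` (Mathlib
`integral_bilinear_fderiv_right_eq_neg_left_of_integrable` coordinatewise). [folklore] -/
theorem weightedSlice_stretching {v w : E3 → E3} (hv : ContDiff ℝ 1 v) (hw : ContDiff ℝ 2 w)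
    (hdivw : ∀ x, VectorCalculus.divergence w x = 0) {M B W₀ : ℝ} (hM : ∀ x, ‖v x‖ ≤ M)
    (hB : ∀ x, ‖fderiv ℝ v x‖ ≤ B) (hwt : ∀ x, (‖w x‖ ^ 2 + 1) ^ (1 / 4 : ℝ) ≤ W₀)
    (l2w : ∫⁻ x, ‖w x‖ₑ ^ 2 < ⊤)
    (l2dw : ∀ i, ∫⁻ x, ‖fderiv ℝ w x (EuclideanSpace.basisFun (Fin 3) ℝ i)‖ₑ ^ 2 < ⊤) :
    Integrable (fun x => (‖w x‖ ^ 2 + 1) ^ (1 / 4 : ℝ) * ⟪w x, fderiv ℝ v x (w x)⟫) volume ∧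
    Integrable (fun x => ⟪fderiv ℝ Φ[w] x (w x), v x⟫) volume ∧
    ∫ x, (‖w x‖ ^ 2 + 1) ^ (1 / 4 : ℝ) * ⟪w x, fderiv ℝ v x (w x)⟫ =
      -∫ x, ⟪fderiv ℝ Φ[w] x (w x), v x⟫ := by
  set e := EuclideanSpace.basisFun (Fin 3) ℝ with he
  have he1 : ∀ i, ‖e i‖ = 1 := fun i => by simp [he]
  -- regularity and continuity
  have hw1 : ContDiff ℝ 1 w := hw.of_le (by norm_num)
  have hdw : Differentiable ℝ w := hw1.differentiable one_ne_zero
  have hdv : Differentiable ℝ v := hv.differentiable one_ne_zero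
  have hΦs : ContDiff ℝ 1 Φ[w] :=
    (((hw1.norm_sq ℝ).add contDiff_const).rpow_const_of_ne fun x => by positivity).smul hw1
  have hdΦ : Differentiable ℝ Φ[w] := hΦs.differentiable one_ne_zero
  have hfs : ∀ j, ContDiff ℝ 1 (fun y => ⟪e j, w y⟫ • Φ[w] y) := fun j =>
    (contDiff_const.inner ℝ hw1).smul hΦs
  have hdf : ∀ j, Differentiable ℝ (fun y => ⟪e j, w y⟫ • Φ[w] y) := fun j =>
    (hfs j).differentiable one_ne_zero
  have cv : Continuous v := hv.continuous
  have cw : Continuous w := hw.continuous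
  have cΦ : Continuous Φ[w] := hΦs.continuous
  have cf : ∀ j, Continuous (fun y => ⟪e j, w y⟫ • Φ[w] y) := fun j => (hfs j).continuous
  have cdw : ∀ i, Continuous fun x => fderiv ℝ w x (e i) := fun i =>
    (hw1.continuous_fderiv one_ne_zero).clm_apply continuous_const
  have cdv : ∀ i, Continuous fun x => fderiv ℝ v x (e i) := fun i =>
    (hv.continuous_fderiv one_ne_zero).clm_apply continuous_const
  have cdf : ∀ j, Continuous fun x => fderiv ℝ (fun y => ⟪e j, w y⟫ • Φ[w] y) x (e j) := fun j =>
    ((hfs j).continuous_fderiv one_ne_zero).clm_apply continuous_const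
  -- the derivative of `wⱼ Φ(w)`
  have hdfj : ∀ j x, fderiv ℝ (fun y => ⟪e j, w y⟫ • Φ[w] y) x (e j) =
      ⟪e j, fderiv ℝ w x (e j)⟫ • ((‖w x‖ ^ 2 + 1) ^ (1 / 4 : ℝ) • w x) +
        ⟪e j, w x⟫ • fderiv ℝ Φ[w] x (e j) := fun j x =>
    fderiv_inner_smul_apply hw1 (hdΦ x) (e j) (e j)
  -- pointwise bounds
  have hei : ∀ i (y : E3), ‖⟪e i, y⟫‖ ≤ ‖y‖ := fun i y =>
    (norm_inner_le_norm (𝕜 := ℝ) (e i) y).trans (by rw [he1, one_mul])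
  have nΦ : ∀ x, ‖(‖w x‖ ^ 2 + 1) ^ (1 / 4 : ℝ) • w x‖ ≤ W₀ * ‖w x‖ := fun x => by
    rw [norm_weight_smul]
    exact mul_le_mul_of_nonneg_right (hwt x) (norm_nonneg _)
  have ndΦ : ∀ x i, ‖fderiv ℝ Φ[w] x (e i)‖ ≤ 3 / 2 * W₀ * ‖fderiv ℝ w x (e i)‖ := fun x i => by
    rw [fderiv_weightedField_apply (hdw x) (e i)]
    calc _ ≤ 3 / 2 * (‖w x‖ ^ 2 + 1) ^ (1 / 4 : ℝ) * ‖fderiv ℝ w x (e i)‖ :=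
          norm_weightedField_deriv_le (w x) (fderiv ℝ w x (e i))
      _ ≤ 3 / 2 * W₀ * ‖fderiv ℝ w x (e i)‖ := by gcongr; exact hwt x
  have nf : ∀ j x, ‖⟪e j, w x⟫ • Φ[w] x‖ ≤ W₀ * ‖w x‖ * ‖w x‖ := fun j x =>
    calc _ = ‖⟪e j, w x⟫‖ * ‖(‖w x‖ ^ 2 + 1) ^ (1 / 4 : ℝ) • w x‖ := norm_smul _ _
      _ ≤ ‖w x‖ * (W₀ * ‖w x‖) := mul_le_mul (hei j (w x)) (nΦ x) (norm_nonneg _) (norm_nonneg _)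
      _ = W₀ * ‖w x‖ * ‖w x‖ := by ring
  have ndf : ∀ j x, ‖fderiv ℝ (fun y => ⟪e j, w y⟫ • Φ[w] y) x (e j)‖ ≤
      5 / 2 * W₀ * ‖w x‖ * ‖fderiv ℝ w x (e j)‖ := fun j x => by
    rw [hdfj j x]
    have t1 : ‖⟪e j, fderiv ℝ w x (e j)⟫ • ((‖w x‖ ^ 2 + 1) ^ (1 / 4 : ℝ) • w x)‖ ≤
        ‖fderiv ℝ w x (e j)‖ * (W₀ * ‖w x‖) :=
      (norm_smul _ _).trans_le (mul_le_mul (hei j _) (nΦ x) (norm_nonneg _) (norm_nonneg _))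
    have t2 : ‖⟪e j, w x⟫ • fderiv ℝ Φ[w] x (e j)‖ ≤ ‖w x‖ * (3 / 2 * W₀ * ‖fderiv ℝ w x (e j)‖) :=
      (norm_smul _ _).trans_le (mul_le_mul (hei j _) (ndΦ x j) (norm_nonneg _) (norm_nonneg _))
    calc _ ≤ _ := norm_add_le _ _
      _ ≤ ‖fderiv ℝ w x (e j)‖ * (W₀ * ‖w x‖) + ‖w x‖ * (3 / 2 * W₀ * ‖fderiv ℝ w x (e j)‖) :=
          add_le_add t1 t2
      _ = 5 / 2 * W₀ * ‖w x‖ * ‖fderiv ℝ w x (e j)‖ := by ring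
  -- integrability of the three pairings of the integration by parts
  have s1 : ∀ j, Integrable (fun x => ⟪fderiv ℝ (fun y => ⟪e j, w y⟫ • Φ[w] y) x (e j), v x⟫)
      volume := fun j => by
    refine integrable_of_norm_le_const_mul_mul (5 / 2 * W₀ * M) ((cdf j).inner cv) cw (cdw j)
      l2w (l2dw j) fun x => ?_
    have hM0 : 0 ≤ M := (norm_nonneg _).trans (hM x)
    calc _ ≤ ‖fderiv ℝ (fun y => ⟪e j, w y⟫ • Φ[w] y) x (e j)‖ * ‖v x‖ := norm_inner_le_norm _ _
      _ ≤ 5 / 2 * W₀ * ‖w x‖ * ‖fderiv ℝ w x (e j)‖ * M :=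
          mul_le_mul (ndf j x) (hM x) (norm_nonneg _) (by
            have := ndf j x
            exact (norm_nonneg _).trans this)
      _ = 5 / 2 * W₀ * M * ‖w x‖ * ‖fderiv ℝ w x (e j)‖ := by ring
  have s2 : ∀ j, Integrable (fun x => ⟪⟪e j, w x⟫ • Φ[w] x, fderiv ℝ v x (e j)⟫) volume :=
    fun j => by
    refine integrable_of_norm_le_const_mul_mul (W₀ * B) ((cf j).inner (cdv j)) cw cw l2w l2w
      fun x => ?_
    have hdvj : ‖fderiv ℝ v x (e j)‖ ≤ B :=
      ((fderiv ℝ v x).le_opNorm (e j)).trans (by rw [he1, mul_one]; exact hB x)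
    calc _ ≤ ‖⟪e j, w x⟫ • Φ[w] x‖ * ‖fderiv ℝ v x (e j)‖ := norm_inner_le_norm _ _
      _ ≤ W₀ * ‖w x‖ * ‖w x‖ * B :=
          mul_le_mul (nf j x) hdvj (norm_nonneg _) ((norm_nonneg _).trans (nf j x))
      _ = W₀ * B * ‖w x‖ * ‖w x‖ := by ring
  have s3 : ∀ j, Integrable (fun x => ⟪⟪e j, w x⟫ • Φ[w] x, v x⟫) volume := fun j => by
    refine integrable_of_norm_le_const_mul_mul (W₀ * M) ((cf j).inner cv) cw cw l2w l2w
      fun x => ?_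
    calc _ ≤ ‖⟪e j, w x⟫ • Φ[w] x‖ * ‖v x‖ := norm_inner_le_norm _ _
      _ ≤ W₀ * ‖w x‖ * ‖w x‖ * M :=
          mul_le_mul (nf j x) (hM x) (norm_nonneg _) ((norm_nonneg _).trans (nf j x))
      _ = W₀ * M * ‖w x‖ * ‖w x‖ := by ring
  -- coordinatewise integration by parts
  have hIBP : ∀ j, ∫ x, ⟪⟪e j, w x⟫ • Φ[w] x, fderiv ℝ v x (e j)⟫ =
      -∫ x, ⟪fderiv ℝ (fun y => ⟪e j, w y⟫ • Φ[w] y) x (e j), v x⟫ := fun j =>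
    integral_bilinear_fderiv_right_eq_neg_left_of_integrable (μ := volume)
      (B := (innerSL ℝ : E3 →L[ℝ] E3 →L[ℝ] ℝ)) (f := fun y => ⟪e j, w y⟫ • Φ[w] y) (g := v)
      (v := e j) (by exact s1 j) (by exact s2 j) (by exact s3 j) (fun x _ => hdf j x)
      (fun x _ => hdv x)
  -- expansion of the weighted stretching density along the coordinates of `w`
  have hexp1 : ∀ x, (‖w x‖ ^ 2 + 1) ^ (1 / 4 : ℝ) * ⟪w x, fderiv ℝ v x (w x)⟫ =
      ∑ j, ⟪⟪e j, w x⟫ • Φ[w] x, fderiv ℝ v x (e j)⟫ := fun x => by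
    have hDv : fderiv ℝ v x (w x) = ∑ j, ⟪e j, w x⟫ • fderiv ℝ v x (e j) := by
      conv_lhs => rw [← e.sum_repr' (w x)]
      rw [map_sum]
      simp_rw [map_smul]
    rw [hDv, inner_sum, Finset.mul_sum]
    refine Finset.sum_congr rfl fun j _ => ?_
    rw [real_inner_smul_right, real_inner_smul_left, real_inner_smul_left]
    ring
  -- `Σⱼ ∂ⱼ(wⱼ Φ(w)) = (div w) Φ(w) + D(Φ∘w)(w) = D(Φ∘w)(w)`
  have hexp2 : ∀ x, ∑ j, ⟪fderiv ℝ (fun y => ⟪e j, w y⟫ • Φ[w] y) x (e j), v x⟫ =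
      ⟪fderiv ℝ Φ[w] x (w x), v x⟫ := fun x => by
    have hD : fderiv ℝ Φ[w] x (w x) = ∑ j, ⟪e j, w x⟫ • fderiv ℝ Φ[w] x (e j) := by
      conv_lhs => rw [← e.sum_repr' (w x)]
      rw [map_sum]
      simp_rw [map_smul]
    simp_rw [hdfj, ← sum_inner, Finset.sum_add_distrib, ← hD, ← Finset.sum_smul,
      ← divergence_eq_sum_inner_fderiv e w x, hdivw x, zero_smul, zero_add]
  -- assemble
  have hfun : (fun x => (‖w x‖ ^ 2 + 1) ^ (1 / 4 : ℝ) * ⟪w x, fderiv ℝ v x (w x)⟫) =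
      fun x => ∑ j, ⟪⟪e j, w x⟫ • Φ[w] x, fderiv ℝ v x (e j)⟫ := funext hexp1
  have iStr : Integrable (fun x => ⟪fderiv ℝ Φ[w] x (w x), v x⟫) volume :=
    (integrable_finsetSum Finset.univ fun j _ => s1 j).congr (Eventually.of_forall hexp2)
  refine ⟨?_, iStr, ?_⟩
  · rw [hfun]
    exact integrable_finsetSum Finset.univ fun j _ => s2 j
  · rw [hfun, integral_finsetSum _ fun j _ => s2 j]
    simp_rw [hIBP]
    rw [Finset.sum_neg_distrib, ← integral_finsetSum _ fun j _ => s1 j]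
    congr 1
    exact integral_congr_ae (Eventually.of_forall hexp2)

/-- **Registered sub-goal of `stub_weightedVorticitySlice` (integration-by-parts file): the
stretching term integrated by parts onto the velocity**, `weightedSlice_stretching` in closed
form. [folklore] -/
theorem stub_weightedVorticitySlice_stretching :
    ∀ ⦃v w : EuclideanSpace ℝ (Fin 3) → EuclideanSpace ℝ (Fin 3)⦄,
      ContDiff ℝ 1 v → ContDiff ℝ 2 w → (∀ x, VectorCalculus.divergence w x = 0) →
    ∀ ⦃M B W₀ : ℝ⦄, (∀ x, ‖v x‖ ≤ M) → (∀ x, ‖fderiv ℝ v x‖ ≤ B) →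
      (∀ x, (‖w x‖ ^ 2 + 1) ^ (1 / 4 : ℝ) ≤ W₀) → (∫⁻ x, ‖w x‖ₑ ^ 2 < ⊤) →
      (∀ i, ∫⁻ x, ‖fderiv ℝ w x (EuclideanSpace.basisFun (Fin 3) ℝ i)‖ₑ ^ 2 < ⊤) →
      ∫ x, (‖w x‖ ^ 2 + 1) ^ (1 / 4 : ℝ) * ⟪w x, fderiv ℝ v x (w x)⟫ =
        -∫ x, ⟪fderiv ℝ (fun y => (‖w y‖ ^ 2 + 1) ^ (1 / 4 : ℝ) • w y) x (w x), v x⟫ :=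
  fun _ _ hv hw hdivw _ _ _ hM hB hwt l2w l2dw =>
    (weightedSlice_stretching hv hw hdivw hM hB hwt l2w l2dw).2.2

end Summit.NavierStokesRegularity.NavierStokesRegularity.Theorems.RungReynoldsOne

end
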